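/-
Copyright (c) 2026 the pub-hodgecm-mathlib formalisation cell (harness21).  Prover seat hodgecm-mathlib-K2Liu-p08 (g2), Track B «K2-LIT»,
#184♮ = hLiu418 = `stmt-HodgeConjecture-24832`; K2E5-plan (g6) CO-DEAL 2026-09-04T07:39:22Z «§G1 RESIDUAL» (LEAD F0P6-plan (g12) 07:37:26Z (a)),
census `K2/K2Liu-p08/g2/CENSUS-G1END-ResidueLieDerivativeStandard.K2Liu-p08-g2.md` (q3).  Second of the three G1-END files.
-/
import Summits.HodgeConjecture.HodgeConjecture.Theorems.K2LiuIwasawaHeightLieDerivative      -- ★ (D-ht): `heightDeriv`, `hasDerivAt_iwasawaHeight_orbit`, …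
import Summits.HodgeConjecture.HodgeConjecture.Theorems.K2LiuIwasawaHeightContinuous         -- ★ #31c: the descent road, `isClosed_siegelDelta`
import Summits.HodgeConjecture.HodgeConjecture.Theorems.K2LiuFlatSectionLieDerivative        -- ★ G2-PS-A: `heightDeriv_delta_mul`
import HarnessLib

/-!
# Crux `HLiu418`, Road I v3, organ G1 (END): THE HEIGHT LOG-DERIVATIVE `H_X = heightDeriv 𝒦 S X` IS CONTINUOUS (standard data)

Cell `hodgecm-mathlib`, crux item hLiu418 = `stmt-HodgeConjecture-24832`; co-dealer K2E5-plan (g6), LEAD F0P6-plan (g12).  THEOREMS ONLY (no `def`,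
no instance, no notation, no named-fact hypothesis, no `sorry`); lane `--supports stmt-HodgeConjecture-24832 --as helper` (count-neutral).
Consumer: the G1-END file `K2LiuResidueLieDerivativeStandard` — socket #41 (`sig_K2LiuSiegelEisensteinContinuation`) is applied to the standard
family `f₂ = stdExt(H_X·φ)` of ★ `K2LiuFlatSectionLieDerivative.hasDerivAt_stdExtension_orbit`, and #41 wants `∀ s, Continuous (f₂ s)`, i.e.
CONTINUITY OF `H_X` (★ (D-ht) `K2LiuIwasawaHeightLieDerivative` delivered `hH` and `K`-finiteness, not continuity: `heightDeriv` is defined through the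
CHOICE `𝒦.kPart`).

THE MATHEMATICS.
* §1 `continuous_of_siegelDelta_invariant` — DESCENT: a function `G` on `H(𝔸)` that is LEFT `P_Δ(𝔸)`-invariant and whose restriction to the compact
  `K` of an Iwasawa datum is continuous, is continuous.  (The road of ★ `K2LiuIwasawaHeightContinuous.continuous_iwasawaHeight` verbatim:
  `h ↦ G(h⁻¹)` descends to the coset space `H(𝔸) ⧸ P_Δ(𝔸)`, Hausdorff since `P_Δ(𝔸)` is closed ★ `isClosed_siegelDelta`; `k ↦ ⟦k⁻¹⟧` is a
  continuous surjection from the compact `K`, hence a quotient map, and the descended function pulled back to `K` is `G|_K`.)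
* §2 `continuous_heightDeriv` — for a STANDARD datum (frame `S`, `C_∞`, ★ `IwasawaDatum.IsStd.exists_arch`): `H_X(p h) = H_X(h)` is ★
  `heightDeriv_delta_mul` (fed with ★ `hasDerivAt_iwasawaHeight_orbit`), and ON `K` ★ `heightDeriv_mul_K` at the base point `1` reads
  `H_X(k) = (D gramHeightFun_{S,c₁})(1)(−k_∞ X k_∞⁻¹)` — a continuous linear form of the continuous `k ↦ Ad(k_∞)X` (★ `continuous_archPart`).
* §3 **`exists_heightDeriv_continuous_of_isStd`** — `∃ H, hH ∧ IsKFinite H ∧ Continuous H`: the by-value inputs of ★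
  `hasDerivAt_stdExtension_orbit` AND the continuity #41 needs, for every standard datum (upgrade of ★ `exists_heightDeriv_of_isStd`);
  `continuous_ofReal_mul` — `h ↦ (H h : ℂ) · φ h` is continuous for continuous `H`, `φ`.
[Garrett2018, §3.10] [MoeglinWaldspurger1995, I.2.2] [KudlaRallis1994, §1] [Knapp2002, 0.§2 Prop. 0.11] [BorelJacquet1979, §4.1] [Tan1999, §1 p. 166].
HONEST LABEL.  Count-neutral helper; `HC_CM` is proved only modulo the 7 printed citations (2 remaining named inputs: hLiu418 =
`stmt-HodgeConjecture-24832`, h413 = `stmt-HodgeConjecture-24833`) until rung 0 closes.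
-/

set_option autoImplicit false
set_option linter.dupNamespace false -- the mandated namespace repeats `HodgeConjecture.HodgeConjecture`

noncomputable section

open Literature.NumberTheory.Automorphic Literature.NumberTheory.Automorphic.UnitaryGroup
open Literature.NumberTheory.GaloisRepresentations
open Literature.NumberTheory.GelbartRogawski1991 Literature.NumberTheory.GelbartRogawski1991.GRConstruction
open Literature.NumberTheory.K2Lit.SiegelDoubled
-- `Classical` is needed to see the Mathlib normed-space instances on `mixedSpace L` (note H5 of `AdelicGLnGlue`)
open scoped Classical
open scoped Matrix Matrix.Norms.Operator Topology
open NumberField NumberField.mixedEmbedding NumberField.InfinitePlace IsDedekindDomain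

namespace Summit.HodgeConjecture.HodgeConjecture.Cruxes.HLiu418.K2LiuIwasawaHeightDerivContinuous

open Summit.HodgeConjecture.HodgeConjecture.Cruxes.HLiu418.K2LiuArchOneParameterOrbitDefs
open Summit.HodgeConjecture.HodgeConjecture.Cruxes.HLiu418.K2LiuIwasawaHeightLieDerivativeDefs
open Summit.HodgeConjecture.HodgeConjecture.Cruxes.HLiu418.K2LiuIwasawaHeightLieDerivative
open Summit.HodgeConjecture.HodgeConjecture.Cruxes.HLiu418.K2LiuIwasawaDeltaUnimodular (IwasawaDatum.modDelta_eq_one_of_mem)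
open Summit.HodgeConjecture.HodgeConjecture.Cruxes.HLiu418.K2LiuFlatSectionLieDerivative (heightDeriv_delta_mul)

variable (L : Type) [Field L] [NumberField L] [IsCMField L]
variable {N M n : ℕ} (e : Fin N × Fin M ≃ Fin n)
  (dV : Fin N → L) (hdV : ∀ i, IsCMField.complexConj L (dV i) = dV i) (hdV0 : ∀ i, dV i ≠ 0)
  (dW : Fin M → L) (hdW : ∀ i, IsCMField.complexConj L (dW i) = dW i) (hdW0 : ∀ i, dW i ≠ 0)
variable (𝒦 : IwasawaDatum L e dV hdV dW hdW)

/-! ## §1 Descent: left `P_Δ(𝔸)`-invariant and continuous on `K` ⇒ continuous -/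

/-- **DESCENT FROM THE COMPACT `K`.**  A function `G : H(𝔸) → Y` with `G(p h) = G(h)` for `p ∈ P_Δ(𝔸)` whose restriction to `K` is continuous is
continuous on `H(𝔸)` (`H(𝔸) ⧸ P_Δ(𝔸)` is Hausdorff, `K → H(𝔸) ⧸ P_Δ(𝔸)`, `k ↦ ⟦k⁻¹⟧` is a quotient map by Iwasawa + compactness).
[cite: Garrett2018, §3.10] [cite: MoeglinWaldspurger1995, I.2.2] -/
theorem continuous_of_siegelDelta_invariant {Y : Type*} [TopologicalSpace Y] {G : HA L e dV hdV dW hdW → Y}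
    (hGP : ∀ p : HA L e dV hdV dW hdW, IsSiegelDelta L e dV hdV dW hdW p → ∀ h : HA L e dV hdV dW hdW, G (p * h) = G h)
    (hGK : Continuous fun k : 𝒦.K => G (k : HA L e dV hdV dW hdW)) : Continuous G := by
  let P : Subgroup (HA L e dV hdV dW hdW) := siegelDelta L e dV hdV dW hdW
  haveI : IsClosed ((P : Subgroup (HA L e dV hdV dW hdW)) : Set (HA L e dV hdV dW hdW)) :=
    K2LiuSiegelDoubledParabolicReduction.isClosed_siegelDelta L e dV hdV dW hdW
  -- `a ↦ G a⁻¹` descends to the coset space `H ⧸ P_Δ`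
  have hdesc : ∀ a b : HA L e dV hdV dW hdW, QuotientGroup.leftRel P a b → G a⁻¹ = G b⁻¹ := by
    intro a b hab
    rw [QuotientGroup.leftRel_apply] at hab
    have hb : b⁻¹ = (a⁻¹ * b)⁻¹ * a⁻¹ := by group
    rw [hb, hGP _ (isSiegelDelta_inv L e dV hdV dW hdW ((mem_siegelDelta_iff L e dV hdV dW hdW _).1 hab))]
  let Gbar : HA L e dV hdV dW hdW ⧸ P → Y := Quotient.lift (fun a => G a⁻¹) hdesc
  have hGbar_mk : ∀ a : HA L e dV hdV dW hdW, Gbar (QuotientGroup.mk a) = G a⁻¹ := fun a => rfl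
  -- `ρ : K → H ⧸ P_Δ`, `k ↦ ⟦k⁻¹⟧`: a continuous surjection from a compact space onto a T2 space, hence a quotient map
  haveI : CompactSpace 𝒦.K := isCompact_iff_compactSpace.1 𝒦.isCompact_K
  let ρ : 𝒦.K → HA L e dV hdV dW hdW ⧸ P := fun k => QuotientGroup.mk ((k : HA L e dV hdV dW hdW)⁻¹)
  have hρc : Continuous ρ := QuotientGroup.continuous_mk.comp (continuous_subtype_val.inv)
  have hρs : Function.Surjective ρ := by
    intro q
    induction q using QuotientGroup.induction_on with
    | H h =>
      obtain ⟨p, k, hp, hk, hpk⟩ := 𝒦.iwasawa h⁻¹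
      refine ⟨⟨k, hk⟩, QuotientGroup.eq.2 ?_⟩
      rw [inv_inv, (mem_siegelDelta_iff L e dV hdV dW hdW _)]
      have hkh : k * h = p⁻¹ := eq_inv_of_mul_eq_one_right (by rw [← mul_assoc, ← hpk, inv_mul_cancel])
      rw [hkh]
      exact isSiegelDelta_inv L e dV hdV dW hdW hp
  have hρq : Topology.IsQuotientMap ρ := (hρc.isClosedMap).isQuotientMap hρc hρs
  -- `Gbar ∘ ρ = G|_K` is continuous
  have hcomp : Gbar ∘ ρ = fun k : 𝒦.K => G (k : HA L e dV hdV dW hdW) := by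
    funext k
    simp only [Function.comp_apply, ρ, hGbar_mk, inv_inv]
  have hGbar_c : Continuous Gbar := hρq.continuous_iff.2 (by rw [hcomp]; exact hGK)
  -- hence `G = Gbar ∘ mk ∘ inv` is continuous
  have hG : G = Gbar ∘ QuotientGroup.mk ∘ fun h : HA L e dV hdV dW hdW => h⁻¹ := by
    funext h
    simp only [Function.comp_apply, hGbar_mk, inv_inv]
  rw [hG]
  exact hGbar_c.comp (QuotientGroup.continuous_mk.comp continuous_inv)

/-! ## §2 The height log-derivative of a standard datum is continuous -/

section Std

variable {X : Matrix (Fin (n + n)) (Fin (n + n)) (mixedSpace L)}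
  (hX : X ∈ archSkew (Fp L) L (IsCMField.complexConj L) (n + n) (hermD L e dV hdV dW hdW))
variable {Cinf : Subgroup (arch (Fp L) L (IsCMField.complexConj L) (n + n) (hermD L e dV hdV dW hdW))}
  {S : GL (Fin (n + n)) (mixedSpace L)}

/-- `k ↦ Ad(k_∞) X = k_∞ X k_∞⁻¹` is continuous on `H(𝔸)` (★ `continuous_archPart`). [cite: Knapp2002, 0.§2 Prop. 0.11] [cite: BorelJacquet1979, §4.1] -/
theorem continuous_ad_archPart (X : Matrix (Fin (n + n)) (Fin (n + n)) (mixedSpace L)) :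
    Continuous fun k : HA L e dV hdV dW hdW =>
      (((archPart (Fp L) L (IsCMField.complexConj L) (n + n) (hermD L e dV hdV dW hdW) k :
          arch (Fp L) L (IsCMField.complexConj L) (n + n) (hermD L e dV hdV dW hdW)) : GL (Fin (n + n)) (mixedSpace L)) :
          Matrix (Fin (n + n)) (Fin (n + n)) (mixedSpace L)) * X *
        (((archPart (Fp L) L (IsCMField.complexConj L) (n + n) (hermD L e dV hdV dW hdW) k :
          arch (Fp L) L (IsCMField.complexConj L) (n + n) (hermD L e dV hdV dW hdW))⁻¹ : GL (Fin (n + n)) (mixedSpace L)) :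
          Matrix (Fin (n + n)) (Fin (n + n)) (mixedSpace L)) := by
  have hA : Continuous fun k : HA L e dV hdV dW hdW =>
      ((archPart (Fp L) L (IsCMField.complexConj L) (n + n) (hermD L e dV hdV dW hdW) k :
        arch (Fp L) L (IsCMField.complexConj L) (n + n) (hermD L e dV hdV dW hdW)) : GL (Fin (n + n)) (mixedSpace L)) :=
    continuous_subtype_val.comp (continuous_archPart (Fp L) L (IsCMField.complexConj L) (n + n) (hermD L e dV hdV dW hdW))
  have h1 : Continuous fun k : HA L e dV hdV dW hdW =>
      (((archPart (Fp L) L (IsCMField.complexConj L) (n + n) (hermD L e dV hdV dW hdW) k :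
        arch (Fp L) L (IsCMField.complexConj L) (n + n) (hermD L e dV hdV dW hdW)) : GL (Fin (n + n)) (mixedSpace L)) :
        Matrix (Fin (n + n)) (Fin (n + n)) (mixedSpace L)) :=
    Units.continuous_val.comp hA
  have h2 : Continuous fun k : HA L e dV hdV dW hdW =>
      (((archPart (Fp L) L (IsCMField.complexConj L) (n + n) (hermD L e dV hdV dW hdW) k :
        arch (Fp L) L (IsCMField.complexConj L) (n + n) (hermD L e dV hdV dW hdW))⁻¹ : GL (Fin (n + n)) (mixedSpace L)) :
        Matrix (Fin (n + n)) (Fin (n + n)) (mixedSpace L)) := by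
    have h3 : Continuous fun k : HA L e dV hdV dW hdW =>
        (((archPart (Fp L) L (IsCMField.complexConj L) (n + n) (hermD L e dV hdV dW hdW) k :
          arch (Fp L) L (IsCMField.complexConj L) (n + n) (hermD L e dV hdV dW hdW))⁻¹ : GL (Fin (n + n)) (mixedSpace L))) :=
      continuous_subtype_val.comp (continuous_archPart (Fp L) L (IsCMField.complexConj L) (n + n) (hermD L e dV hdV dW hdW)).inv
    exact Units.continuous_val.comp h3
  exact (h1.mul continuous_const).mul h2

include hX hdV0 hdW0 in
/-- **`H_X = heightDeriv 𝒦 S X` IS CONTINUOUS** for a standard datum in its frame `S` (descent §1: left `P_Δ`-invariance ★ `heightDeriv_delta_mul`,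
and on `K` the formula ★ `heightDeriv_mul_K` at `h = 1`). [cite: KudlaRallis1994, §1] [cite: Tan1999, §1 p. 166] [cite: Garrett2018, §3.10] -/
theorem continuous_heightDeriv (h𝒦 : 𝒦.IsStd)
    (hC : ∀ a : arch (Fp L) L (IsCMField.complexConj L) (n + n) (hermD L e dV hdV dW hdW),
      a ∈ Cinf ↔ S⁻¹ * (a : GL (Fin (n + n)) (mixedSpace L)) * S ∈
        arch (Fp L) L (IsCMField.complexConj L) (n + n) (1 : Matrix (Fin (n + n)) (Fin (n + n)) L))
    (hKC : ∀ k : HA L e dV hdV dW hdW, k ∈ 𝒦.K →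
      archPart (Fp L) L (IsCMField.complexConj L) (n + n) (hermD L e dV hdV dW hdW) k ∈ Cinf) :
    Continuous (heightDeriv 𝒦 S X) := by
  refine continuous_of_siegelDelta_invariant L e dV hdV dW hdW 𝒦 (fun p hp h => ?_) ?_
  · -- left `P_Δ`-invariance
    exact heightDeriv_delta_mul hX (IwasawaDatum.modDelta_eq_one_of_mem L e dV hdV hdV0 dW hdW hdW0 𝒦)
      (hasDerivAt_iwasawaHeight_orbit L e dV hdV hdV0 dW hdW hdW0 𝒦 hX h𝒦 hC hKC) hp h
  · -- on `K`: `H_X(k) = Λ(−Ad(k_∞)X)` with `Λ = D gramHeightFun_{S,c₁}(1)`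
    set Λ := fderiv ℝ (gramHeightFun L S (archPart (Fp L) L (IsCMField.complexConj L) (n + n) (hermD L e dV hdV dW hdW)
      (𝒦.kPart 1) : GL (Fin (n + n)) (mixedSpace L))) 1 with hΛ
    have hfun : (fun k : 𝒦.K => heightDeriv 𝒦 S X (k : HA L e dV hdV dW hdW)) = fun k : 𝒦.K =>
        Λ (-((((archPart (Fp L) L (IsCMField.complexConj L) (n + n) (hermD L e dV hdV dW hdW) (k : HA L e dV hdV dW hdW) :
            arch (Fp L) L (IsCMField.complexConj L) (n + n) (hermD L e dV hdV dW hdW)) : GL (Fin (n + n)) (mixedSpace L)) :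
            Matrix (Fin (n + n)) (Fin (n + n)) (mixedSpace L)) * X *
          (((archPart (Fp L) L (IsCMField.complexConj L) (n + n) (hermD L e dV hdV dW hdW) (k : HA L e dV hdV dW hdW) :
            arch (Fp L) L (IsCMField.complexConj L) (n + n) (hermD L e dV hdV dW hdW))⁻¹ : GL (Fin (n + n)) (mixedSpace L)) :
            Matrix (Fin (n + n)) (Fin (n + n)) (mixedSpace L)))) := by
      funext k
      have h1 := heightDeriv_mul_K L e dV hdV hdV0 dW hdW hdW0 𝒦 hX h𝒦 hC hKC 1 k.2
      rw [one_mul] at h1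
      rw [h1]
    rw [hfun]
    exact Λ.continuous.comp ((continuous_ad_archPart L e dV hdV dW hdW X).comp continuous_subtype_val).neg

end Std

/-! ## §3 The by-value package for the G-road: existence, `K`-finiteness AND continuity -/

section Package

variable {X : Matrix (Fin (n + n)) (Fin (n + n)) (mixedSpace L)}
  (hX : X ∈ archSkew (Fp L) L (IsCMField.complexConj L) (n + n) (hermD L e dV hdV dW hdW))

include hdV0 hdW0 in
/-- **«(D-ht)» WITH CONTINUITY**: for a standard Iwasawa datum and `X ∈ 𝔥_∞` there is `H : H(𝔸) → ℝ` with
`hH : ∀ h, HasDerivAt (fun t => Φ_𝒦(h · γ_X t)) (Φ_𝒦 h · H h) 0`, `IsKFinite 𝒦 H` and `Continuous H` (★ `exists_heightDeriv_of_isStd` + §2).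
[cite: KudlaRallis1994, §1] [cite: Tan1999, §1 p. 166] [cite: HarrisKudlaSweet1996, (1.16)] -/
theorem exists_heightDeriv_continuous_of_isStd (h𝒦 : 𝒦.IsStd) :
    ∃ H : HA L e dV hdV dW hdW → ℝ,
      (∀ h : HA L e dV hdV dW hdW,
        HasDerivAt (fun t : ℝ => modDelta L e dV hdV dW hdW (𝒦.pPart
            (h * archExp (Fp L) L (IsCMField.complexConj L) (n + n) (hermD L e dV hdV dW hdW) hX t)))
          (modDelta L e dV hdV dW hdW (𝒦.pPart h) * H h) 0) ∧
      IsKFinite 𝒦 (fun h => (H h : ℂ)) ∧ Continuous H := by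
  obtain ⟨Cinf, S, -, hC, -, hKC⟩ := h𝒦.exists_arch
  exact ⟨heightDeriv 𝒦 S X, hasDerivAt_iwasawaHeight_orbit L e dV hdV hdV0 dW hdW hdW0 𝒦 hX h𝒦 hC hKC,
    isKFinite_heightDeriv L e dV hdV hdV0 dW hdW hdW0 𝒦 hX h𝒦 hC hKC,
    continuous_heightDeriv L e dV hdV hdV0 dW hdW hdW0 𝒦 hX h𝒦 hC hKC⟩

omit [NumberField L] [IsCMField L] in
/-- continuity of `h ↦ (H h : ℂ) · φ h` for continuous real `H` and continuous `φ` (the `s₀`-member `H·φ` of the family `f₂ = stdExt(H·φ)`).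
[cite: KudlaRallis1994, §1] -/
theorem continuous_ofReal_mul {Z : Type*} [TopologicalSpace Z] {H : Z → ℝ} {φ : Z → ℂ} (hH : Continuous H) (hφ : Continuous φ) :
    Continuous fun h => (H h : ℂ) * φ h :=
  (Complex.continuous_ofReal.comp hH).mul hφ

end Package

end Summit.HodgeConjecture.HodgeConjecture.Cruxes.HLiu418.K2LiuIwasawaHeightDerivContinuous

end
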